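import Summits.QuantumFields.YangMills.Theses.ForcedResponseSkewness
import Summits.QuantumFields.YangMills.Theorems.ForcedResponseSkewnessRunningCouplingCeilingOfKernelBoundsBody
import HarnessLib

/-!
# Crux `RunningCouplingCeiling` (repaired: stmt-QuantumFields-24275): the crux BY NAME from pointwise kernel bounds

Support file (`--supports stmt-QuantumFields-24275`) by the width prover `ym-line-frs-p3` of route `ForcedResponseSkewness`
(lead `ym-line-frs-p1`): the named one-liners over `…RunningCouplingCeilingOfKernelBoundsBody` (which concludes the crux
TEXT verbatim and was landed while the farm could not serve the route module after rev 3):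

* `runningCouplingCeiling_of_pointwiseSigR : PointwiseSigR → RunningCouplingCeiling` — the registered physics stub of line
  «pointwise-log-ceiling-r» gives the repaired crux (the registered smear stub `SmearUniformSig` being landed, p593756 /
  `uniform_smear` p592574);
* `runningCouplingCeiling_of_localKernelBounds` — the same from the LOCAL physics stub (scale-free clause only at
  physical separation `≤ ℓ`, running-coupling clause below half the unit; via `uniform_smear_local` p593330), whose
  scale-free half is `MomentBounds6|_{n=2}` (`localScaleFree_of_momentBounds6`, p593932).

Honest label: CONDITIONAL reductions inside a conditional rung line (leaf R2a `BalabanLadder.NT`); the kernel bounds are NOT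
proved here; nothing in this file bears on the Yang–Mills mass gap, which is NOT proved by any of this.
-/

set_option autoImplicit false

noncomputable section

namespace Summit.QuantumFields.YangMills.Cruxes.RunningCouplingCeiling.Pointwise

open scoped SchwartzMap
open MeasureTheory Filter Topology
open Literature.MathematicalPhysics.QuantumFieldTheory Literature.MathematicalPhysics.QuantumLattice
open Literature.Probability.LatticeModels
open Summit.QuantumFields.YangMills.Cruxes.OSLegsFromFemtoAndGap.DlrCollarTransfer
open Summit.QuantumFields.YangMills.Theses.ForcedResponseSkewness

/-- **`PointwiseSigR → RunningCouplingCeiling`** (stmt-QuantumFields-24275): the registered physics stub of line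
«pointwise-log-ceiling-r» implies the repaired crux, the smearing half being landed. [folklore] -/
theorem runningCouplingCeiling_of_pointwiseSigR (hpt : PointwiseSigR) : RunningCouplingCeiling :=
  runningCouplingCeilingBody_of_pointwiseSigR hpt

/-- **The repaired crux from the LOCAL physics stub**: for every compact simple `G`, `r`, unit map `a → 0⁺` with a
compactly supported positive-time clause-(i) floor witness and every physical radius `ℓ > 0`, constants with
`n₀ ≤ d → a(β) d ≤ ℓ → d⁸|torusCov| ≤ C₁` and `n₀ ≤ d → a(β) d ≤ ½ → d⁸|torusCov| ≤ C₀/log²(1/(a(β) d))` on all large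
tori ⇒ `RunningCouplingCeiling`. [folklore] -/
theorem runningCouplingCeiling_of_localKernelBounds
    (hpt : ∀ (G : Type) [Group G] [TopologicalSpace G] [IsTopologicalGroup G] [CompactSpace G],
      IsCompactSimpleLieGroup G →
      letI : MeasurableSpace G := borel G
      haveI : BorelSpace G := ⟨rfl⟩
      ∀ (r : LatticeRep G) (a : ℝ → ℝ), (∀ β, 0 < a β) → Filter.Tendsto a Filter.atTop (nhds 0) →
        (∃ (v₀ : 𝓢(EuclideanSpace ℝ (Fin 4), ℝ)) (ε β₅ Λ₅ : ℝ), HasCompactSupport v₀ ∧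
          tsupport v₀ ⊆ {y : EuclideanSpace ℝ (Fin 4) | 0 < y 0} ∧ 0 < ε ∧
          ∀ β : ℝ, β₅ ≤ β → ∀ L : ℕ, Λ₅ ≤ a β * L → ε ≤ Q2 G r β L (a β) (thetaTest 4 v₀) v₀) →
        ∀ ℓ : ℝ, 0 < ℓ → ∃ C₀ C₁ : ℝ, ∃ n₀ : ℕ, ∃ β₀ Λ₀ : ℝ, ∀ β : ℝ, β₀ ≤ β → ∀ L : ℕ, Λ₀ ≤ a β * L →
          ∀ x ∈ box 4 L, ∀ y ∈ box 4 L,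
            (((n₀ : ℝ) ≤ torusDist L x y → a β * torusDist L x y ≤ ℓ →
                torusDist L x y ^ 8 * |torusCov G r β L x y| ≤ C₁) ∧
             ((n₀ : ℝ) ≤ torusDist L x y → a β * torusDist L x y ≤ 1 / 2 →
                torusDist L x y ^ 8 * |torusCov G r β L x y| ≤
                  C₀ / Real.log (1 / (a β * torusDist L x y)) ^ 2))) :
    RunningCouplingCeiling :=
  runningCouplingCeilingBody_of_localKernelBounds hpt

end Summit.QuantumFields.YangMills.Cruxes.RunningCouplingCeiling.Pointwise

end
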